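import Summits.Parity.GeneralizedHardyLittlewood.Theorems.PrimeLevelFamEdgeMomentsBeyondDiagonalDiagDecorM8Block
import Summits.Parity.GeneralizedHardyLittlewood.Theorems.PrimeLevelFamEdgeMomentsBeyondDiagonalDiagDecorShiftedLpow
import HarnessLib

/-!
# Route `PrimeLevelFamEdge`, crux K_A `MomentsBeyondDiagonal` (stmt-Parity-20007), line «petersson_layers» v4, stub `stub_diag`:
# **the `M₈`-FAMILY Selberg-form bounds: `|Sel(τ(105P₂⁴−420P₂²P₄+448P₂P₆+140P₄²−272P₈)(k₁)·τ(k₂)·L^m)| ≤ C·log^{m+4}M` and the mirror, every `m`**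
# (the `M₈`-twin of `…DiagDecorM4Family`; the input of the orders `(i,j) = (4,4)` of `stub_diag`)

From `…DiagDecorM8Block.abs_selbergBlockM8_le` by `L = 2B + ℓ⁺(k₁) + ℓ⁺(k₂)` and the `k₁ ↔ k₂` symmetry:

* `tauM8Tau_Lpow_eq_sum_blocks` — the pointwise block expansion;
* `abs_selbergM8Lpow_le`, `abs_selbergM8Lpow_le'` — **the displayed bounds** (`0 ≤ λ ≤ 1`, `P₀ = P₁ = 0`, `M ≥ 3`).

In order `(4,4)` these monomials (`M₈(k₁)·τ(k₂)·L^m`, `m ≤ 1`, and the mirror) are thereby inside the `O(log⁵M)` error of the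
polynomial part — the third and last new engine of order `(4,4)` after `…DiagDecorM6P2Family` and `…DiagDecorM4M4Family`.
Def-free; theorems only. Helper `--supports stmt-Parity-20007`; closes nothing; K_A, K_B and the Parity summit are NOT proved;
nothing about Landau–Siegel zeros.

## References
* E. Kowalski, P. Michel, J. VanderKam, J. reine angew. Math. 526 (2000), (23)–(28) pp. 13–15 and Prop. 5.1 p. 18.
  [cite: KowalskiMichelVanderKam2000, (23)–(28) — derivation (diagonal main term in real Selberg coordinates)]
-/

noncomputable section

open scoped Real ArithmeticFunction.Moebius
open Finset ArithmeticFunction Polynomial MeasureTheory intervalIntegral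

namespace Summit.Parity.GeneralizedHardyLittlewood.Theorems.MomentsBeyondDiagonal.DiagKernel

open Literature.NumberTheory.LFunctions Literature.NumberTheory.LFunctions.KMV2000
open Literature.NumberTheory.Sieve (one_le_log_of_three_le)

/-- **Pointwise block expansion** (`M > 0`, `c, g, k₁, k₂ ≥ 1`; `ℓ⁺(k) = log((M/(cg))/k)`, `B = λlog M − log g − log(M/(cg))`,
`D = 105P₂⁴ − 420P₂²P₄ + 448P₂P₆ + 140P₄² − 272P₈`): `τ(k₁)D(k₁)τ(k₂)L^m = Σ_{j≤m}Σ_{i≤j} C(m,j)C(j,i)2^{m−j}(τD(k₁)ℓ⁺(k₁)^i)(τ(k₂)ℓ⁺(k₂)^{j−i})B^{m−j}`.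
[cite: KowalskiMichelVanderKam2000, (23) — derivation] -/
theorem tauM8Tau_Lpow_eq_sum_blocks {M : ℝ} (hM : 0 < M) (lam : ℝ) (m : ℕ) {c g k₁ k₂ : ℕ} (hc : c ≠ 0)
    (hg : g ≠ 0) (hk₁ : k₁ ≠ 0) (hk₂ : k₂ ≠ 0) :
    (k₁.divisors.card : ℝ) * (105 * (∑ q ∈ k₁.primeFactors, Real.log q ^ 2) ^ 4 -
            420 * (∑ q ∈ k₁.primeFactors, Real.log q ^ 2) ^ 2 * (∑ q ∈ k₁.primeFactors, Real.log q ^ 4) +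
            448 * (∑ q ∈ k₁.primeFactors, Real.log q ^ 2) * (∑ q ∈ k₁.primeFactors, Real.log q ^ 6) +
            140 * (∑ q ∈ k₁.primeFactors, Real.log q ^ 4) ^ 2 -
            272 * ∑ q ∈ k₁.primeFactors, Real.log q ^ 8) *
        (k₂.divisors.card : ℝ) * (2 * (lam * Real.log M) - 2 * Real.log g - Real.log k₁ - Real.log k₂) ^ m =
      ∑ j ∈ Finset.range (m + 1), ∑ i ∈ Finset.range (j + 1),
        (m.choose j : ℝ) * (j.choose i : ℝ) * 2 ^ (m - j) *
          (((k₁.divisors.card : ℝ) *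
                  (105 * (∑ q ∈ k₁.primeFactors, Real.log q ^ 2) ^ 4 -
            420 * (∑ q ∈ k₁.primeFactors, Real.log q ^ 2) ^ 2 * (∑ q ∈ k₁.primeFactors, Real.log q ^ 4) +
            448 * (∑ q ∈ k₁.primeFactors, Real.log q ^ 2) * (∑ q ∈ k₁.primeFactors, Real.log q ^ 6) +
            140 * (∑ q ∈ k₁.primeFactors, Real.log q ^ 4) ^ 2 -
            272 * ∑ q ∈ k₁.primeFactors, Real.log q ^ 8) *
                  Real.log (M / ((c * g : ℕ) : ℝ) / k₁) ^ i) *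
                ((k₂.divisors.card : ℝ) * Real.log (M / ((c * g : ℕ) : ℝ) / k₂) ^ (j - i)) *
                (lam * Real.log M - Real.log g - Real.log (M / ((c * g : ℕ) : ℝ))) ^ (m - j)) := by
  have key : ∀ d : ℝ,
      (k₁.divisors.card : ℝ) * d *
          (k₂.divisors.card : ℝ) * (2 * (lam * Real.log M) - 2 * Real.log g - Real.log k₁ - Real.log k₂) ^ m =
        ∑ j ∈ Finset.range (m + 1), ∑ i ∈ Finset.range (j + 1),
          (m.choose j : ℝ) * (j.choose i : ℝ) * 2 ^ (m - j) *
            (((k₁.divisors.card : ℝ) *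
                    d *
                    Real.log (M / ((c * g : ℕ) : ℝ) / k₁) ^ i) *
                  ((k₂.divisors.card : ℝ) * Real.log (M / ((c * g : ℕ) : ℝ) / k₂) ^ (j - i)) *
                  (lam * Real.log M - Real.log g - Real.log (M / ((c * g : ℕ) : ℝ))) ^ (m - j)) := by
    intro d
    have hcg : (0 : ℝ) < ((c * g : ℕ) : ℝ) := by exact_mod_cast Nat.pos_of_ne_zero (mul_ne_zero hc hg)
    have hY : M / ((c * g : ℕ) : ℝ) ≠ 0 := (div_pos hM hcg).ne'
    have h1 : Real.log (M / ((c * g : ℕ) : ℝ) / k₁) = Real.log (M / ((c * g : ℕ) : ℝ)) - Real.log k₁ :=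
      Real.log_div hY (by exact_mod_cast hk₁)
    have h2 : Real.log (M / ((c * g : ℕ) : ℝ) / k₂) = Real.log (M / ((c * g : ℕ) : ℝ)) - Real.log k₂ :=
      Real.log_div hY (by exact_mod_cast hk₂)
    have hL : (2 * (lam * Real.log M) - 2 * Real.log g - Real.log k₁ - Real.log k₂) =
        (Real.log (M / ((c * g : ℕ) : ℝ) / k₁) + Real.log (M / ((c * g : ℕ) : ℝ) / k₂)) +
          2 * (lam * Real.log M - Real.log g - Real.log (M / ((c * g : ℕ) : ℝ))) := by
      rw [h1, h2]; ring
    rw [hL, add_pow, Finset.mul_sum]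
    refine Finset.sum_congr rfl fun j _ ↦ ?_
    rw [add_pow, mul_pow, Finset.sum_mul, Finset.sum_mul, Finset.mul_sum]
    refine Finset.sum_congr rfl fun i _ ↦ ?_
    ring
  exact key _

/-- **`|Sel(τ(105P₂⁴−420P₂²P₄+448P₂P₆+140P₄²−272P₈)(k₁)·τ(k₂)·L^m)| ≤ C·log^{m+4} M`** for every `m` (`0 ≤ λ ≤ 1`, `P₀ = P₁ = 0`, `M ≥ 3`).
[cite: KowalskiMichelVanderKam2000, (23)–(28) — derivation] -/
theorem abs_selbergM8Lpow_le (P : ℝ[X]) (hP0 : P.coeff 0 = 0) (hP1 : P.coeff 1 = 0) (m : ℕ)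
    {lam : ℝ} (hlam0 : 0 ≤ lam) (hlam1 : lam ≤ 1) :
    ∃ C : ℝ, 0 < C ∧ ∀ M : ℝ, 3 ≤ M →
      |∑ c ∈ Icc 1 ⌊M⌋₊, ∑ g ∈ Icc 1 (⌊M⌋₊ / c), (μ g : ℝ) * c *
          ∑ k₁ ∈ Icc 1 (⌊M⌋₊ / (c * g)), ∑ k₂ ∈ Icc 1 (⌊M⌋₊ / (c * g)),
            ((μ (c * g * k₁) : ℝ) * ((psi (c * g * k₁))⁻¹ *
                P.eval (Real.log (M / ((c * g * k₁ : ℕ) : ℝ)) / Real.log M))) / ((c * g * k₁ : ℕ) : ℝ) *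
              (((μ (c * g * k₂) : ℝ) * ((psi (c * g * k₂))⁻¹ *
                P.eval (Real.log (M / ((c * g * k₂ : ℕ) : ℝ)) / Real.log M))) / ((c * g * k₂ : ℕ) : ℝ)) *
              ((k₁.divisors.card : ℝ) * (105 * (∑ p ∈ k₁.primeFactors, Real.log p ^ 2) ^ 4 -
            420 * (∑ p ∈ k₁.primeFactors, Real.log p ^ 2) ^ 2 * (∑ p ∈ k₁.primeFactors, Real.log p ^ 4) +
            448 * (∑ p ∈ k₁.primeFactors, Real.log p ^ 2) * (∑ p ∈ k₁.primeFactors, Real.log p ^ 6) +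
            140 * (∑ p ∈ k₁.primeFactors, Real.log p ^ 4) ^ 2 -
            272 * ∑ p ∈ k₁.primeFactors, Real.log p ^ 8) *
                (k₂.divisors.card : ℝ) * (2 * (lam * Real.log M) - 2 * Real.log g - Real.log k₁ - Real.log k₂) ^ m)| ≤
        C * Real.log M ^ (m + 4) := by
  have hex : ∀ j i : ℕ, ∃ C : ℝ, 0 < C ∧ ∀ M : ℝ, 3 ≤ M →
      |∑ c ∈ Icc 1 ⌊M⌋₊, ∑ g ∈ Icc 1 (⌊M⌋₊ / c), (μ g : ℝ) * c *
          ∑ k₁ ∈ Icc 1 (⌊M⌋₊ / (c * g)), ∑ k₂ ∈ Icc 1 (⌊M⌋₊ / (c * g)),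
            ((μ (c * g * k₁) : ℝ) * ((psi (c * g * k₁))⁻¹ *
                P.eval (Real.log (M / ((c * g * k₁ : ℕ) : ℝ)) / Real.log M))) / ((c * g * k₁ : ℕ) : ℝ) *
              (((μ (c * g * k₂) : ℝ) * ((psi (c * g * k₂))⁻¹ *
                P.eval (Real.log (M / ((c * g * k₂ : ℕ) : ℝ)) / Real.log M))) / ((c * g * k₂ : ℕ) : ℝ)) *
              (((k₁.divisors.card : ℝ) *
                  (105 * (∑ q ∈ k₁.primeFactors, Real.log q ^ 2) ^ 4 -
            420 * (∑ q ∈ k₁.primeFactors, Real.log q ^ 2) ^ 2 * (∑ q ∈ k₁.primeFactors, Real.log q ^ 4) +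
            448 * (∑ q ∈ k₁.primeFactors, Real.log q ^ 2) * (∑ q ∈ k₁.primeFactors, Real.log q ^ 6) +
            140 * (∑ q ∈ k₁.primeFactors, Real.log q ^ 4) ^ 2 -
            272 * ∑ q ∈ k₁.primeFactors, Real.log q ^ 8) *
                  Real.log (M / ((c * g : ℕ) : ℝ) / k₁) ^ i) *
                ((k₂.divisors.card : ℝ) * Real.log (M / ((c * g : ℕ) : ℝ) / k₂) ^ (j - i)) *
                (lam * Real.log M - Real.log g - Real.log (M / ((c * g : ℕ) : ℝ))) ^ (m - j))| ≤
        C * Real.log M ^ ((m - j) + i + (j - i) + 4) := by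
    intro j i
    exact abs_selbergBlockM8_le P hP0 hP1 (m - j) i (j - i) hlam0 hlam1
  choose Cb hCb0 hCb using hex
  set K : ℝ := ∑ j ∈ Finset.range (m + 1), ∑ i ∈ Finset.range (j + 1),
    (m.choose j : ℝ) * (j.choose i : ℝ) * 2 ^ (m - j) * Cb j i with hK
  have hK0 : 0 ≤ K := Finset.sum_nonneg fun j _ ↦ Finset.sum_nonneg fun i _ ↦ by
    have := hCb0 j i; positivity
  refine ⟨K + 1, by positivity, fun M hM ↦ ?_⟩
  have hℓ1 : 1 ≤ Real.log M := one_le_log_of_three_le hM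
  have hM0 : 0 < M := by linarith
  -- Step 1: expand the weight pointwise and use linearity
  have hpt : ∀ c ∈ Icc 1 ⌊M⌋₊, ∀ g ∈ Icc 1 (⌊M⌋₊ / c), ∀ k₁ ∈ Icc 1 (⌊M⌋₊ / (c * g)), ∀ k₂ ∈ Icc 1 (⌊M⌋₊ / (c * g)),
      ((μ (c * g * k₁) : ℝ) * ((psi (c * g * k₁))⁻¹ *
          P.eval (Real.log (M / ((c * g * k₁ : ℕ) : ℝ)) / Real.log M))) / ((c * g * k₁ : ℕ) : ℝ) *
        (((μ (c * g * k₂) : ℝ) * ((psi (c * g * k₂))⁻¹ *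
          P.eval (Real.log (M / ((c * g * k₂ : ℕ) : ℝ)) / Real.log M))) / ((c * g * k₂ : ℕ) : ℝ)) *
        ((k₁.divisors.card : ℝ) * (105 * (∑ p ∈ k₁.primeFactors, Real.log p ^ 2) ^ 4 -
            420 * (∑ p ∈ k₁.primeFactors, Real.log p ^ 2) ^ 2 * (∑ p ∈ k₁.primeFactors, Real.log p ^ 4) +
            448 * (∑ p ∈ k₁.primeFactors, Real.log p ^ 2) * (∑ p ∈ k₁.primeFactors, Real.log p ^ 6) +
            140 * (∑ p ∈ k₁.primeFactors, Real.log p ^ 4) ^ 2 -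
            272 * ∑ p ∈ k₁.primeFactors, Real.log p ^ 8) *
                (k₂.divisors.card : ℝ) * (2 * (lam * Real.log M) - 2 * Real.log g - Real.log k₁ - Real.log k₂) ^ m) =
      ((μ (c * g * k₁) : ℝ) * ((psi (c * g * k₁))⁻¹ *
          P.eval (Real.log (M / ((c * g * k₁ : ℕ) : ℝ)) / Real.log M))) / ((c * g * k₁ : ℕ) : ℝ) *
        (((μ (c * g * k₂) : ℝ) * ((psi (c * g * k₂))⁻¹ *
          P.eval (Real.log (M / ((c * g * k₂ : ℕ) : ℝ)) / Real.log M))) / ((c * g * k₂ : ℕ) : ℝ)) *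
        ∑ j ∈ Finset.range (m + 1), (fun (j c g k₁ k₂ : ℕ) ↦ ∑ i ∈ Finset.range (j + 1),
          (m.choose j : ℝ) * (j.choose i : ℝ) * 2 ^ (m - j) *
          (((k₁.divisors.card : ℝ) *
                  (105 * (∑ q ∈ k₁.primeFactors, Real.log q ^ 2) ^ 4 -
            420 * (∑ q ∈ k₁.primeFactors, Real.log q ^ 2) ^ 2 * (∑ q ∈ k₁.primeFactors, Real.log q ^ 4) +
            448 * (∑ q ∈ k₁.primeFactors, Real.log q ^ 2) * (∑ q ∈ k₁.primeFactors, Real.log q ^ 6) +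
            140 * (∑ q ∈ k₁.primeFactors, Real.log q ^ 4) ^ 2 -
            272 * ∑ q ∈ k₁.primeFactors, Real.log q ^ 8) *
                  Real.log (M / ((c * g : ℕ) : ℝ) / k₁) ^ i) *
                ((k₂.divisors.card : ℝ) * Real.log (M / ((c * g : ℕ) : ℝ) / k₂) ^ (j - i)) *
                (lam * Real.log M - Real.log g - Real.log (M / ((c * g : ℕ) : ℝ))) ^ (m - j))) j c g k₁ k₂ := by
    intro c hc g hg k₁ hk₁ k₂ hk₂
    have hc0 : c ≠ 0 := by have := (Finset.mem_Icc.1 hc).1; omega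
    have hg0 : g ≠ 0 := by have := (Finset.mem_Icc.1 hg).1; omega
    have hk₁0 : k₁ ≠ 0 := by have := (Finset.mem_Icc.1 hk₁).1; omega
    have hk₂0 : k₂ ≠ 0 := by have := (Finset.mem_Icc.1 hk₂).1; omega
    rw [tauM8Tau_Lpow_eq_sum_blocks hM0 lam m hc0 hg0 hk₁0 hk₂0]
  rw [Finset.sum_congr rfl fun c hc ↦ Finset.sum_congr rfl fun g hg ↦ congrArg _
    (Finset.sum_congr rfl fun k₁ hk₁ ↦ Finset.sum_congr rfl fun k₂ hk₂ ↦ hpt c hc g hg k₁ hk₁ k₂ hk₂),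
    selbergProd_finset_sum P M (Finset.range (m + 1))]
  rw [Finset.sum_congr rfl fun j _ ↦ selbergProd_finset_sum P M (Finset.range (j + 1))
    (fun (i c g k₁ k₂ : ℕ) ↦ (m.choose j : ℝ) * (j.choose i : ℝ) * 2 ^ (m - j) *
      (((k₁.divisors.card : ℝ) *
                  (105 * (∑ q ∈ k₁.primeFactors, Real.log q ^ 2) ^ 4 -
            420 * (∑ q ∈ k₁.primeFactors, Real.log q ^ 2) ^ 2 * (∑ q ∈ k₁.primeFactors, Real.log q ^ 4) +
            448 * (∑ q ∈ k₁.primeFactors, Real.log q ^ 2) * (∑ q ∈ k₁.primeFactors, Real.log q ^ 6) +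
            140 * (∑ q ∈ k₁.primeFactors, Real.log q ^ 4) ^ 2 -
            272 * ∑ q ∈ k₁.primeFactors, Real.log q ^ 8) *
                  Real.log (M / ((c * g : ℕ) : ℝ) / k₁) ^ i) *
                ((k₂.divisors.card : ℝ) * Real.log (M / ((c * g : ℕ) : ℝ) / k₂) ^ (j - i)) *
                (lam * Real.log M - Real.log g - Real.log (M / ((c * g : ℕ) : ℝ))) ^ (m - j)))]
  simp only [selbergProd_const_mul]
  -- Step 2: termwise crude bounds
  have hterm : ∀ j ∈ Finset.range (m + 1),
      |∑ i ∈ Finset.range (j + 1), (m.choose j : ℝ) * (j.choose i : ℝ) * 2 ^ (m - j) *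
          ∑ c ∈ Icc 1 ⌊M⌋₊, ∑ g ∈ Icc 1 (⌊M⌋₊ / c), (μ g : ℝ) * c *
          ∑ k₁ ∈ Icc 1 (⌊M⌋₊ / (c * g)), ∑ k₂ ∈ Icc 1 (⌊M⌋₊ / (c * g)),
            ((μ (c * g * k₁) : ℝ) * ((psi (c * g * k₁))⁻¹ *
                P.eval (Real.log (M / ((c * g * k₁ : ℕ) : ℝ)) / Real.log M))) / ((c * g * k₁ : ℕ) : ℝ) *
              (((μ (c * g * k₂) : ℝ) * ((psi (c * g * k₂))⁻¹ *
                P.eval (Real.log (M / ((c * g * k₂ : ℕ) : ℝ)) / Real.log M))) / ((c * g * k₂ : ℕ) : ℝ)) *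
              (((k₁.divisors.card : ℝ) *
                  (105 * (∑ q ∈ k₁.primeFactors, Real.log q ^ 2) ^ 4 -
            420 * (∑ q ∈ k₁.primeFactors, Real.log q ^ 2) ^ 2 * (∑ q ∈ k₁.primeFactors, Real.log q ^ 4) +
            448 * (∑ q ∈ k₁.primeFactors, Real.log q ^ 2) * (∑ q ∈ k₁.primeFactors, Real.log q ^ 6) +
            140 * (∑ q ∈ k₁.primeFactors, Real.log q ^ 4) ^ 2 -
            272 * ∑ q ∈ k₁.primeFactors, Real.log q ^ 8) *
                  Real.log (M / ((c * g : ℕ) : ℝ) / k₁) ^ i) *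
                ((k₂.divisors.card : ℝ) * Real.log (M / ((c * g : ℕ) : ℝ) / k₂) ^ (j - i)) *
                (lam * Real.log M - Real.log g - Real.log (M / ((c * g : ℕ) : ℝ))) ^ (m - j))| ≤
        (∑ i ∈ Finset.range (j + 1), (m.choose j : ℝ) * (j.choose i : ℝ) * 2 ^ (m - j) * Cb j i) * Real.log M ^ (m + 4) := by
    intro j hj
    have hjm : j ≤ m := Nat.lt_succ_iff.1 (Finset.mem_range.1 hj)
    rw [Finset.sum_mul]
    refine (Finset.abs_sum_le_sum_abs _ _).trans (Finset.sum_le_sum fun i hi ↦ ?_)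
    have hij : i ≤ j := Nat.lt_succ_iff.1 (Finset.mem_range.1 hi)
    have e : (m - j) + i + (j - i) + 4 = m + 4 := by omega
    have h := hCb j i M hM
    rw [e] at h
    rw [abs_mul, abs_of_nonneg (by positivity : (0 : ℝ) ≤ (m.choose j : ℝ) * (j.choose i : ℝ) * 2 ^ (m - j)),
      mul_assoc ((m.choose j : ℝ) * (j.choose i : ℝ) * 2 ^ (m - j)) (Cb j i) (Real.log M ^ (m + 4))]
    exact mul_le_mul_of_nonneg_left h (by positivity)
  refine (Finset.abs_sum_le_sum_abs _ _).trans ((Finset.sum_le_sum hterm).trans ?_)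
  rw [← Finset.sum_mul, ← hK]
  gcongr; linarith

/-- **The mirror `|Sel(τ(k₁)·τ(105P₂⁴−420P₂²P₄+448P₂P₆+140P₄²−272P₈)(k₂)·L^m)| ≤ C·log^{m+4} M`** (decoration on the second variable), by the
`k₁ ↔ k₂` symmetry of the Selberg form. [cite: KowalskiMichelVanderKam2000, (23)–(28) — derivation] -/
theorem abs_selbergM8Lpow_le' (P : ℝ[X]) (hP0 : P.coeff 0 = 0) (hP1 : P.coeff 1 = 0) (m : ℕ)
    {lam : ℝ} (hlam0 : 0 ≤ lam) (hlam1 : lam ≤ 1) :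
    ∃ C : ℝ, 0 < C ∧ ∀ M : ℝ, 3 ≤ M →
      |∑ c ∈ Icc 1 ⌊M⌋₊, ∑ g ∈ Icc 1 (⌊M⌋₊ / c), (μ g : ℝ) * c *
          ∑ k₁ ∈ Icc 1 (⌊M⌋₊ / (c * g)), ∑ k₂ ∈ Icc 1 (⌊M⌋₊ / (c * g)),
            ((μ (c * g * k₁) : ℝ) * ((psi (c * g * k₁))⁻¹ *
                P.eval (Real.log (M / ((c * g * k₁ : ℕ) : ℝ)) / Real.log M))) / ((c * g * k₁ : ℕ) : ℝ) *
              (((μ (c * g * k₂) : ℝ) * ((psi (c * g * k₂))⁻¹ *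
                P.eval (Real.log (M / ((c * g * k₂ : ℕ) : ℝ)) / Real.log M))) / ((c * g * k₂ : ℕ) : ℝ)) *
              ((k₁.divisors.card : ℝ) * ((k₂.divisors.card : ℝ) *
                (105 * (∑ p ∈ k₂.primeFactors, Real.log p ^ 2) ^ 4 -
            420 * (∑ p ∈ k₂.primeFactors, Real.log p ^ 2) ^ 2 * (∑ p ∈ k₂.primeFactors, Real.log p ^ 4) +
            448 * (∑ p ∈ k₂.primeFactors, Real.log p ^ 2) * (∑ p ∈ k₂.primeFactors, Real.log p ^ 6) +
            140 * (∑ p ∈ k₂.primeFactors, Real.log p ^ 4) ^ 2 -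
            272 * ∑ p ∈ k₂.primeFactors, Real.log p ^ 8)) *
                (2 * (lam * Real.log M) - 2 * Real.log g - Real.log k₁ - Real.log k₂) ^ m)| ≤
        C * Real.log M ^ (m + 4) := by
  obtain ⟨C, hC, h⟩ := abs_selbergM8Lpow_le P hP0 hP1 m hlam0 hlam1
  refine ⟨C, hC, fun M hM ↦ ?_⟩
  have hswap : ∀ c g : ℕ, ∑ k₁ ∈ Icc 1 (⌊M⌋₊ / (c * g)), ∑ k₂ ∈ Icc 1 (⌊M⌋₊ / (c * g)),
      ((μ (c * g * k₁) : ℝ) * ((psi (c * g * k₁))⁻¹ *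
          P.eval (Real.log (M / ((c * g * k₁ : ℕ) : ℝ)) / Real.log M))) / ((c * g * k₁ : ℕ) : ℝ) *
        (((μ (c * g * k₂) : ℝ) * ((psi (c * g * k₂))⁻¹ *
          P.eval (Real.log (M / ((c * g * k₂ : ℕ) : ℝ)) / Real.log M))) / ((c * g * k₂ : ℕ) : ℝ)) *
        ((k₁.divisors.card : ℝ) * ((k₂.divisors.card : ℝ) *
                (105 * (∑ p ∈ k₂.primeFactors, Real.log p ^ 2) ^ 4 -
            420 * (∑ p ∈ k₂.primeFactors, Real.log p ^ 2) ^ 2 * (∑ p ∈ k₂.primeFactors, Real.log p ^ 4) +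
            448 * (∑ p ∈ k₂.primeFactors, Real.log p ^ 2) * (∑ p ∈ k₂.primeFactors, Real.log p ^ 6) +
            140 * (∑ p ∈ k₂.primeFactors, Real.log p ^ 4) ^ 2 -
            272 * ∑ p ∈ k₂.primeFactors, Real.log p ^ 8)) *
                (2 * (lam * Real.log M) - 2 * Real.log g - Real.log k₁ - Real.log k₂) ^ m) =
      ∑ k₁ ∈ Icc 1 (⌊M⌋₊ / (c * g)), ∑ k₂ ∈ Icc 1 (⌊M⌋₊ / (c * g)),
      ((μ (c * g * k₁) : ℝ) * ((psi (c * g * k₁))⁻¹ *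
          P.eval (Real.log (M / ((c * g * k₁ : ℕ) : ℝ)) / Real.log M))) / ((c * g * k₁ : ℕ) : ℝ) *
        (((μ (c * g * k₂) : ℝ) * ((psi (c * g * k₂))⁻¹ *
          P.eval (Real.log (M / ((c * g * k₂ : ℕ) : ℝ)) / Real.log M))) / ((c * g * k₂ : ℕ) : ℝ)) *
        ((k₁.divisors.card : ℝ) * (105 * (∑ p ∈ k₁.primeFactors, Real.log p ^ 2) ^ 4 -
            420 * (∑ p ∈ k₁.primeFactors, Real.log p ^ 2) ^ 2 * (∑ p ∈ k₁.primeFactors, Real.log p ^ 4) +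
            448 * (∑ p ∈ k₁.primeFactors, Real.log p ^ 2) * (∑ p ∈ k₁.primeFactors, Real.log p ^ 6) +
            140 * (∑ p ∈ k₁.primeFactors, Real.log p ^ 4) ^ 2 -
            272 * ∑ p ∈ k₁.primeFactors, Real.log p ^ 8) *
                (k₂.divisors.card : ℝ) * (2 * (lam * Real.log M) - 2 * Real.log g - Real.log k₁ - Real.log k₂) ^ m) := by
    intro c g
    rw [Finset.sum_comm]
    refine Finset.sum_congr rfl fun k₁ _ ↦ Finset.sum_congr rfl fun k₂ _ ↦ ?_
    rw [show 2 * (lam * Real.log M) - 2 * Real.log g - Real.log k₂ - Real.log k₁ =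
      2 * (lam * Real.log M) - 2 * Real.log g - Real.log k₁ - Real.log k₂ by ring]
    ring
  rw [Finset.sum_congr rfl fun c _ ↦ Finset.sum_congr rfl fun g _ ↦ congrArg _ (hswap c g)]
  exact h M hM

end Summit.Parity.GeneralizedHardyLittlewood.Theorems.MomentsBeyondDiagonal.DiagKernel

end
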